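import Summits.QuantumFields.YangMills.Theorems.BalabanUVNodesN19RekeyingAscent
import Summits.QuantumFields.YangMills.Theorems.BalabanUVNodesN19AgeScaleTransportBudget
import Mathlib.Analysis.Convex.SpecificFunctions.Basic
import Mathlib.Analysis.Convex.Jensen

/-!
# BalabanUVNodes ∕ node N19 (NE7) — THE AVERAGING GAIN OF A COARSE KEY: inside a fibre the log-ratio of the FIBRE SUMS deviates from the common constant by
# the p-WEIGHTED MEAN of the termwise deviations (times `e^{sup}`), not by their supremum — so `Core` DESCENDS from termwise deviations that are merely BOUNDED
# provided their fibrewise MEAN is summable; with an age-indexed mixture the mean is the age ⊛ scale convolution of Part III's ℓ¹-transport budget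

Cell `pub-ymgap` (HUMAN RULING D-0062 Track A ∕ D-0149 width seats), WIDTH SEAT `pub-ymgap-dag-n19-w1` (node n19 = NE7, seat 1 of 3), generation g3,
INTENT-5.  Route `Summits/QuantumFields/YangMills/Theses/BalabanUVNodes.lean`, key item K3⁷ `SpineGivenEndpointR13SepCoPH` (stmt-QuantumFields-20544; N19′ conjunct
`KeyedCoreEdgeHolderD4` of v4 stub 2); filed `--kind proof --supports … --as helper`.  COUNT-NEUTRAL.  THEOREMS ONLY (0 `def`, 0 `sorry`).  ADDITIVE — imports this seat's g3
`…N19RekeyingAscent` (INTENT-1; through it Part I `…N19RekeyingCalculus`: `classVal_apply`, and `Spine/NE7/Targets`: `Core`, `sandwich_of_abs_log_sub_le`) and `…N19AgeScaleTransportBudget`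
(INTENT-3: `summable_transportedTotal`, `summable_antidiagonal_of_nonneg`), Mathlib's Jensen inequality (`ConcaveOn.le_map_sum`, `strictConcaveOn_log_Ioi`) — CITED BY NAME; modifies nothing.

WHY.  Part I (`core_classVal`) lets `Core` DESCEND along a class map when the fine terms are sandwiched with ONE constant at radius `vol·δ_K` — a SUPREMUM condition over the
terms of every coarse-good fibre.  Part II priced the converse.  But a coarse key does better than Part I says: the fibre SUM averages.  If the fine terms of a coarse-good fibre
deviate from the common constant by `r_s = log q_s − log p_s − c_K` with only a BOUNDED supremum `|r_s| ≤ R` and a small p-WEIGHTED MEAN `Σ_fibre p_s|r_s| ≤ vol·m_K·Σ_fibre p_s`,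
then the fibre sums are sandwiched at radius `e^{R}·vol·m_K` (§1–§2: `log` of a p-weighted mean of `e^{r_s}` lies between the weighted mean of `r_s` (Jensen) and `e^R` times the
weighted mean of `|r_s|`).  This is the mechanism by which the crux idea card `age-scale-convolution` (evidence n°46∕n°47 on 20544; CRIT-1 triage `Cruxes/…/CRIT-1-TRIAGE-…`) expects
the OLD-LARGE-FIELD channel to be summable AT A COARSE KEY although it is not termwise: a healed large-field component of age `n` (born at scale `K − n`) carries a two-run
discrepancy `≤ u (K − n)` that is `O(1)` for the oldest components (so no fine-key `Core` with summable `δ` can hold on those terms — they would have to be BAD, the tree's age cut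
`j⋆(K)` of `T4WeightBudget`), but its p-weight inside a small-field-skeleton class is the activity `a n`; the fibre MEAN is then `Σ_{j+n=K} u j·a n` — Part III's ℓ¹-transport
convolution, summable by `summable_transportedTotal` (§3–§4).  So the two roads to N19′'s slot are: FINE key + age cut (NE7b pays the old components' weight, `Σ_n n·a n < ∞`), or
COARSE key + averaging (no cut; the mean pays) — and §4 types the second road's arithmetic end to end, every physics input a displayed HYPOTHESIS.
* §1 [folklore] `exp_sub_one_le_mul_exp_abs` (`e^r − 1 ≤ |r|·e^R` for `|r| ≤ R`) · ★★ `abs_log_sum_sub_le_weightedMean` — THE MIXTURE LEMMA: positive `p, q` on a non-empty finite set,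
  `|log q_s − log p_s − c| ≤ R` termwise ⇒ `|log Σq − log Σp − c| ≤ e^R · (Σ_s p_s·|log q_s − log p_s − c|) ∕ (Σ_s p_s)` (upper: `log M ≤ M − 1`; lower: Jensen for `log`).
* §2 [folklore] ★★ `core_classVal_of_meanDeviation` — DESCENT WITH AVERAGING: fine terms positive on the coarse-good fibres, ONE constant `c_K` per `K`, termwise deviations `≤ R_K`
  (bounded, NOT assumed small) and fibrewise p-weighted mean deviation `≤ vol·m_K` ⇒ coarse `Core l₀ vol T Bad (classVal S π p) (classVal S π q) (e^{R}·m)` — compare Part I's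
  `core_classVal` (needs the SUP `≤ vol·δ_K`) · `coreEdge_classVal_of_meanDeviation` (`R_K ≤ R` bounded, `m` summable ⇒ the coarse edge `∃ δ, Core ∧ Summable δ`).
* §3 [folklore] `sum_mul_abs_le_of_ageProfile` — AN AGE-INDEXED MIXTURE: if every term of a fibre has an age `≤ K`, a term of age `n` deviates by `≤ d n`, and the age-`n` terms carry
  p-weight fraction `≤ w n`, then the fibre's weighted mean deviation is `≤ Σ_{n ≤ K} w n·d n` · `sum_range_succ_eq_sum_antidiagonal` (`Σ_{n≤K} a n·u (K−n) = Σ_{(j,n) ∈ antidiagonal K} u j·a n`).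
* §4 [folklore ∘ Part III BY NAME] ★★ `coreEdge_classVal_of_ageActivity` — THE COARSE ROAD TYPED END TO END: positive fine terms with ONE constant per `K`, deviation of an age-`n` term
  `≤ u (K − n)` with `0 ≤ u j ≤ C·θ^j` (scale-geometric matching of components by birth scale, `0 ≤ θ < 1`), sup deviation `≤ R`, age-`n` weight fraction `≤ a n` with `a ∈ ℓ¹₊`
  (activity), `0 < vol` ⇒ the COARSE edge `∃ δ, Core l₀ vol T Bad (classVal S π p) (classVal S π q) δ ∧ Summable δ` with `δ_K = e^R·(Σ_{j+n=K} u j·a n)∕vol`.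
READINGS (for the planner ∕ the card's owners; located, nothing proposed).  (i) The K1 mechanism of `age-scale-convolution` is, abstractly, §4: its three physics inputs are the
displayed hypotheses `hdev` (component matching by birth scale), `hwt` (activity as in-class weight fraction), `hR` (bounded worst case); none is in print for d = 4.  (ii) The
road REQUIRES a coarse key (the fibre must contain all ages to average over); at the full-history key of `crOfRecord₁₃V` the same terms force an age CUT into the bad class instead
(Part II §5∕§6: an `O(1)` class gap on good classes is fatal) — the key ∕ cut trade-off in one sentence: «average old components in (coarse key, mean budget `Σ u⊛a`) or cut them
out (fine key, weight budget `Σ_n n·a n`)».  (iii) `e^{R}` is the price of positivity-only matching of the worst components; it is a CONSTANT, not a rate.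

HONEST FRAMING.  Finite-sum ∕ elementary real-analysis bookkeeping [folklore] over the tree's SHAPES; the age profile, the activity, the component matching `u`, `Core` occur as
HYPOTHESES only; nothing of Bałaban's is asserted or instantiated; no estimate of the programme is proved (the card's K1∕K2 remain unprinted physics claims).  NE7 ∕ NE7b NOT PRINTED
as two-run statements for d = 4 ∕ NOT proved; N19 NOT discharged (0∕1); K3⁷ OPEN, not claimed; counts UNMOVED (typed 28∕28 · discharged 5∕27, A 5∕28).  Everything below is PROVED
(0 `sorry`, 0 named facts, standard axioms); no decl carries a cite tag.  One finite four-torus programme at fixed ε — NOT ℝ⁴, NOT infinite volume, NOT OS, NOT a mass gap, NOT the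
Clay problem (R4 closes the conditional finite-𝕋⁴ rung `BalabanLadder.UV` only).
-/

noncomputable section

open Finset
open scoped BigOperators

namespace Summit.QuantumFields.YangMills.BalabanUVNodes.N19FibreAveragingGain

open Summit.QuantumFields.BalabanUV.T4Continuum.Spine.NE7 (Core sandwich_of_abs_log_sub_le)
open Literature.MathematicalPhysics.QuantumFieldTheory.Balaban1983to89
open T4MatchingAssembly (classVal)
open Summit.QuantumFields.YangMills.BalabanUVNodes.N19RekeyingCalculus (classVal_apply)
open Summit.QuantumFields.YangMills.BalabanUVNodes.N19AgeScaleTransportBudget (summable_transportedTotal summable_antidiagonal_of_nonneg)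

/-! ## §1 The mixture lemma: the log of a weighted mean of `e^{r}` against the weighted mean of `|r|` [folklore] -/

section Mixture
variable {σ : Type*}

/-- `e^r − 1 ≤ |r|·e^R` whenever `|r| ≤ R` (from `1 − r ≤ e^{−r}`). [folklore] -/
theorem exp_sub_one_le_mul_exp_abs {r R : ℝ} (hr : |r| ≤ R) : Real.exp r - 1 ≤ |r| * Real.exp R := by
  have h1 : Real.exp r - 1 ≤ r * Real.exp r := by
    have h := Real.add_one_le_exp (-r)
    have he : Real.exp (-r) * Real.exp r = 1 := by rw [← Real.exp_add]; simp
    nlinarith [Real.exp_pos r, Real.exp_pos (-r)]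
  rcases le_or_gt 0 r with h0 | h0
  · calc Real.exp r - 1 ≤ r * Real.exp r := h1
      _ ≤ |r| * Real.exp R := by
          rw [abs_of_nonneg h0]
          exact mul_le_mul_of_nonneg_left (Real.exp_le_exp.mpr ((le_abs_self r).trans hr)) h0
  · have : Real.exp r - 1 < 0 := by linarith [Real.exp_lt_one_iff.mpr h0 |> fun h => (Real.exp_lt_one_iff.mpr h0)]
    exact this.le.trans (mul_nonneg (abs_nonneg r) (Real.exp_pos R).le)

/-- **★★ THE MIXTURE LEMMA** [folklore].  On a non-empty finite set with positive `p`, `q` and termwise `|log q_s − log p_s − c| ≤ R`: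
`|log (Σ q) − log (Σ p) − c| ≤ e^R · (Σ_s p_s·|log q_s − log p_s − c|) ∕ (Σ_s p_s)` — the deviation of the SUMS is the p-WEIGHTED MEAN of the termwise deviations up to the factor
`e^R`, not their supremum `R`.  Upper half: `log M ≤ M − 1` for the weighted mean `M` of `e^{r_s}` and §1's `e^r − 1 ≤ |r|e^R`; lower half: Jensen for the concave `log`
(`strictConcaveOn_log_Ioi.concaveOn.le_map_sum`). -/
theorem abs_log_sum_sub_le_weightedMean {F : Finset σ} {p q : σ → ℝ} {c R : ℝ} (hF : F.Nonempty) (hp : ∀ s ∈ F, 0 < p s) (hq : ∀ s ∈ F, 0 < q s)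
    (hR : ∀ s ∈ F, |Real.log (q s) - Real.log (p s) - c| ≤ R) :
    |Real.log (∑ s ∈ F, q s) - Real.log (∑ s ∈ F, p s) - c| ≤
      Real.exp R * ((∑ s ∈ F, p s * |Real.log (q s) - Real.log (p s) - c|) / ∑ s ∈ F, p s) := by
  -- notation-free abbreviations
  have hP : 0 < ∑ s ∈ F, p s := Finset.sum_pos hp hF
  have hQ : 0 < ∑ s ∈ F, q s := Finset.sum_pos hq hF
  have hR0 : 0 ≤ R := by obtain ⟨s, hs⟩ := hF; exact (abs_nonneg _).trans (hR s hs)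
  -- Σ q = e^c · Σ p_s e^{r_s}
  have hM : (∑ s ∈ F, q s) = Real.exp c * ∑ s ∈ F, p s * Real.exp (Real.log (q s) - Real.log (p s) - c) := by
    rw [Finset.mul_sum]
    refine Finset.sum_congr rfl fun s hs => ?_
    have hp0 : p s ≠ 0 := (hp s hs).ne'
    have hc0 : Real.exp c ≠ 0 := (Real.exp_pos c).ne'
    rw [Real.exp_sub, Real.exp_sub, Real.exp_log (hq s hs), Real.exp_log (hp s hs)]
    field_simp
  have hMpos : 0 < ∑ s ∈ F, p s * Real.exp (Real.log (q s) - Real.log (p s) - c) :=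
    Finset.sum_pos (fun s hs => mul_pos (hp s hs) (Real.exp_pos _)) hF
  have hlog : Real.log (∑ s ∈ F, q s) - Real.log (∑ s ∈ F, p s) - c =
      Real.log ((∑ s ∈ F, p s * Real.exp (Real.log (q s) - Real.log (p s) - c)) / ∑ s ∈ F, p s) := by
    rw [hM, Real.log_mul (Real.exp_pos c).ne' hMpos.ne', Real.log_exp, Real.log_div hMpos.ne' hP.ne']
    ring
  rw [hlog]
  have hratio : 0 < (∑ s ∈ F, p s * Real.exp (Real.log (q s) - Real.log (p s) - c)) / ∑ s ∈ F, p s := div_pos hMpos hP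
  refine abs_le.mpr ⟨?_, ?_⟩
  · -- lower half: Jensen
    have hJ := (strictConcaveOn_log_Ioi.concaveOn).le_map_sum (t := F) (w := fun s => p s / ∑ s ∈ F, p s)
      (p := fun s => Real.exp (Real.log (q s) - Real.log (p s) - c)) (fun s hs => (div_pos (hp s hs) hP).le)
      (by rw [← Finset.sum_div, div_self hP.ne']) (fun s _ => Real.exp_pos _)
    simp only [smul_eq_mul, Real.log_exp] at hJ
    have hmean : (∑ s ∈ F, p s / (∑ s ∈ F, p s) * Real.exp (Real.log (q s) - Real.log (p s) - c)) =
        (∑ s ∈ F, p s * Real.exp (Real.log (q s) - Real.log (p s) - c)) / ∑ s ∈ F, p s := by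
      rw [Finset.sum_div]
      exact Finset.sum_congr rfl fun s _ => by ring
    rw [hmean] at hJ
    have hlow : -(Real.exp R * ((∑ s ∈ F, p s * |Real.log (q s) - Real.log (p s) - c|) / ∑ s ∈ F, p s)) ≤
        ∑ s ∈ F, p s / (∑ s ∈ F, p s) * (Real.log (q s) - Real.log (p s) - c) := by
      rw [mul_div_assoc', Finset.mul_sum, Finset.sum_div, ← Finset.sum_neg_distrib]
      refine Finset.sum_le_sum fun s hs => ?_
      have hw : 0 ≤ p s / ∑ s ∈ F, p s := (div_pos (hp s hs) hP).le
      have h1 : -(|Real.log (q s) - Real.log (p s) - c|) ≤ Real.log (q s) - Real.log (p s) - c := neg_abs_le _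
      have h2 : |Real.log (q s) - Real.log (p s) - c| ≤ Real.exp R * |Real.log (q s) - Real.log (p s) - c| :=
        le_mul_of_one_le_left (abs_nonneg _) (Real.one_le_exp hR0)
      have e : Real.exp R * (p s * |Real.log (q s) - Real.log (p s) - c|) / ∑ s ∈ F, p s =
          p s / (∑ s ∈ F, p s) * (Real.exp R * |Real.log (q s) - Real.log (p s) - c|) := by ring
      rw [e, ← mul_neg]
      exact mul_le_mul_of_nonneg_left (by linarith) hw
    exact hlow.trans hJ
  · -- upper half: log M ≤ M − 1 ≤ e^R · mean |r|
    refine (Real.log_le_sub_one_of_pos hratio).trans ?_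
    rw [mul_div_assoc', Finset.mul_sum, div_sub_one hP.ne', div_le_div_iff_of_pos_right hP, ← Finset.sum_sub_distrib]
    refine Finset.sum_le_sum fun s hs => ?_
    have h := exp_sub_one_le_mul_exp_abs (hR s hs)
    have e : Real.exp R * (p s * |Real.log (q s) - Real.log (p s) - c|) = p s * (|Real.log (q s) - Real.log (p s) - c| * Real.exp R) := by ring
    rw [e, ← mul_sub_one]
    exact mul_le_mul_of_nonneg_left h (hp s hs).le

end Mixture

/-! ## §2 Descent with averaging: bounded termwise deviations with a small fibrewise MEAN give the coarse `Core` [folklore] -/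

section Descent
variable {σ ι : Type*} [DecidableEq ι] {l₀ vol : ℝ} {S : ℕ → Finset σ} {T : ℕ → Finset ι} {π : ℕ → σ → ι} {p q : ℕ → ℝ → σ → ℝ}
  {Bad : ℕ → ℝ → Finset ι} {R m : ℕ → ℝ}

/-- **★★ DESCENT WITH AVERAGING** [folklore].  Fine terms positive on the coarse-good fibres, for every `K` ONE constant `c_K` with TERMWISE deviations
`|log q − log p − c_K| ≤ R_K` on those fibres (bounded — NOT assumed small) and FIBREWISE p-weighted mean deviation `Σ_{fibre} p·|log q − log p − c_K| ≤ vol·m_K·Σ_{fibre} p`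
⇒ the fibre sums satisfy `Core l₀ vol T Bad (classVal S π p) (classVal S π q) (e^{R}·m)` with the constants `c_K` (§1 per coarse-good fibre, then `NE7.sandwich_of_abs_log_sub_le`;
an empty fibre is matched trivially).  Part I's `core_classVal` is the case `m = δ`, `R = vol·δ` with the factor `e^{R}` wasted; the gain is that `R_K` may stay `O(1)`. -/
theorem core_classVal_of_meanDeviation
    (hp : ∀ (K : ℕ) (t : ℝ), |t| ≤ l₀ → ∀ τ ∈ T K \ Bad K t, ∀ s ∈ (S K).filter (fun s => π K s = τ), 0 < p K t s)
    (hq : ∀ (K : ℕ) (t : ℝ), |t| ≤ l₀ → ∀ τ ∈ T K \ Bad K t, ∀ s ∈ (S K).filter (fun s => π K s = τ), 0 < q K t s)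
    (hdev : ∀ K : ℕ, ∃ c : ℝ, ∀ t : ℝ, |t| ≤ l₀ → ∀ τ ∈ T K \ Bad K t,
      (∀ s ∈ (S K).filter (fun s => π K s = τ), |Real.log (q K t s) - Real.log (p K t s) - c| ≤ R K) ∧
      ∑ s ∈ (S K).filter (fun s => π K s = τ), p K t s * |Real.log (q K t s) - Real.log (p K t s) - c| ≤
        vol * m K * ∑ s ∈ (S K).filter (fun s => π K s = τ), p K t s) :
    Core l₀ vol T Bad (classVal S π p) (classVal S π q) (fun K => Real.exp (R K) * m K) := by
  intro K
  obtain ⟨c, hc⟩ := hdev K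
  refine ⟨c, fun t ht τ hτ => ?_⟩
  rw [classVal_apply, classVal_apply]
  rcases ((S K).filter (fun s => π K s = τ)).eq_empty_or_nonempty with hF | hF
  · simp [hF]
  obtain ⟨hsup, hmean⟩ := hc t ht τ hτ
  have hP : 0 < ∑ s ∈ (S K).filter (fun s => π K s = τ), p K t s := Finset.sum_pos (hp K t ht τ hτ) hF
  have h := abs_log_sum_sub_le_weightedMean hF (hp K t ht τ hτ) (hq K t ht τ hτ) hsup
  refine sandwich_of_abs_log_sub_le hP (Finset.sum_pos (hq K t ht τ hτ) hF) (h.trans ?_)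
  rw [show vol * (Real.exp (R K) * m K) = Real.exp (R K) * (vol * m K) by ring]
  exact mul_le_mul_of_nonneg_left ((div_le_iff₀ hP).mpr hmean) (Real.exp_pos _).le

/-- **THE COARSE EDGE FROM A SUMMABLE MEAN** [folklore]: termwise deviations bounded by a constant `R` (all `K`) and a SUMMABLE fibrewise mean letter `m` ⇒
`∃ δ, Core l₀ vol T Bad (classVal S π p) (classVal S π q) δ ∧ Summable δ` — N19′'s slot AT THE COARSE KEY with no termwise smallness at all. -/
theorem coreEdge_classVal_of_meanDeviation {R₀ : ℝ} (hR : ∀ K, R K ≤ R₀)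
    (hp : ∀ (K : ℕ) (t : ℝ), |t| ≤ l₀ → ∀ τ ∈ T K \ Bad K t, ∀ s ∈ (S K).filter (fun s => π K s = τ), 0 < p K t s)
    (hq : ∀ (K : ℕ) (t : ℝ), |t| ≤ l₀ → ∀ τ ∈ T K \ Bad K t, ∀ s ∈ (S K).filter (fun s => π K s = τ), 0 < q K t s)
    (hdev : ∀ K : ℕ, ∃ c : ℝ, ∀ t : ℝ, |t| ≤ l₀ → ∀ τ ∈ T K \ Bad K t,
      (∀ s ∈ (S K).filter (fun s => π K s = τ), |Real.log (q K t s) - Real.log (p K t s) - c| ≤ R K) ∧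
      ∑ s ∈ (S K).filter (fun s => π K s = τ), p K t s * |Real.log (q K t s) - Real.log (p K t s) - c| ≤
        vol * m K * ∑ s ∈ (S K).filter (fun s => π K s = τ), p K t s)
    (hm0 : ∀ K, 0 ≤ m K) (hm : Summable m) :
    ∃ δ : ℕ → ℝ, Core l₀ vol T Bad (classVal S π p) (classVal S π q) δ ∧ Summable δ :=
  ⟨_, core_classVal_of_meanDeviation hp hq hdev,
    Summable.of_nonneg_of_le (fun K => mul_nonneg (Real.exp_pos _).le (hm0 K))
      (fun K => mul_le_mul_of_nonneg_right (Real.exp_le_exp.mpr (hR K)) (hm0 K)) (hm.mul_left (Real.exp R₀))⟩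

end Descent

/-! ## §3 An age-indexed mixture: the weighted mean deviation against an age profile [folklore] -/

section AgeProfile
variable {σ : Type*}

/-- **THE MEAN AGAINST AN AGE PROFILE** [folklore].  On a finite set `F` with non-negative weights `p`, every term having an AGE `age s ≤ K`, a term of age `n` deviating by
`|r_s| ≤ d n` (`d ≥ 0`) and the age-`n` terms carrying p-weight fraction at most `w n` (`Σ_{age = n} p ≤ w n·Σ_F p`): `Σ_F p·|r| ≤ (Σ_{n ≤ K} w n·d n)·Σ_F p`. -/
theorem sum_mul_abs_le_of_ageProfile {F : Finset σ} {p r : σ → ℝ} {age : σ → ℕ} {d w : ℕ → ℝ} {K : ℕ}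
    (hp : ∀ s ∈ F, 0 ≤ p s) (hage : ∀ s ∈ F, age s ≤ K) (hd0 : ∀ n, 0 ≤ d n) (hd : ∀ s ∈ F, |r s| ≤ d (age s))
    (hw : ∀ n, ∑ s ∈ F.filter (fun s => age s = n), p s ≤ w n * ∑ s ∈ F, p s) :
    ∑ s ∈ F, p s * |r s| ≤ (∑ n ∈ range (K + 1), w n * d n) * ∑ s ∈ F, p s := by
  calc ∑ s ∈ F, p s * |r s| ≤ ∑ s ∈ F, p s * d (age s) := Finset.sum_le_sum fun s hs => mul_le_mul_of_nonneg_left (hd s hs) (hp s hs)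
    _ = ∑ n ∈ range (K + 1), ∑ s ∈ F.filter (fun s => age s = n), p s * d (age s) :=
        (Finset.sum_fiberwise_of_maps_to (fun s hs => Finset.mem_range.mpr (Nat.lt_succ_of_le (hage s hs))) _).symm
    _ = ∑ n ∈ range (K + 1), d n * ∑ s ∈ F.filter (fun s => age s = n), p s := by
        refine Finset.sum_congr rfl fun n _ => ?_
        rw [Finset.mul_sum]
        exact Finset.sum_congr rfl fun s hs => by rw [(Finset.mem_filter.mp hs).2, mul_comm]
    _ ≤ ∑ n ∈ range (K + 1), d n * (w n * ∑ s ∈ F, p s) := Finset.sum_le_sum fun n _ => mul_le_mul_of_nonneg_left (hw n) (hd0 n)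
    _ = (∑ n ∈ range (K + 1), w n * d n) * ∑ s ∈ F, p s := by rw [Finset.sum_mul]; exact Finset.sum_congr rfl fun n _ => by ring

/-- The age sum IS the antidiagonal convolution of Part III: `Σ_{n ≤ K} a n·u (K − n) = Σ_{(j,n) ∈ antidiagonal K} u j·a n`. [folklore] -/
theorem sum_range_succ_eq_sum_antidiagonal (a u : ℕ → ℝ) (K : ℕ) :
    ∑ n ∈ range (K + 1), a n * u (K - n) = ∑ x ∈ antidiagonal K, u x.1 * a x.2 := by
  rw [← Finset.Nat.sum_antidiagonal_swap, Finset.Nat.sum_antidiagonal_eq_sum_range_succ (fun i j => u (Prod.swap (i, j)).1 * a (Prod.swap (i, j)).2) K]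
  exact Finset.sum_congr rfl fun n _ => by simp [mul_comm]

end AgeProfile

/-! ## §4 The coarse road typed end to end: age profile + activity + birth-scale matching ⇒ the coarse edge [folklore ∘ Part III] -/

section CoarseRoad
variable {σ ι : Type*} [DecidableEq ι] {l₀ vol : ℝ} {S : ℕ → Finset σ} {T : ℕ → Finset ι} {π : ℕ → σ → ι} {p q : ℕ → ℝ → σ → ℝ}
  {Bad : ℕ → ℝ → Finset ι} {age : ℕ → ℝ → σ → ℕ} {u a : ℕ → ℝ} {C θ R : ℝ}

/-- **★★ THE COARSE ROAD, END TO END** [folklore ∘ Part III BY NAME].  Fine terms positive on the coarse-good fibres; for every `K` ONE constant `c_K`; every term of a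
coarse-good fibre has an AGE `≤ K` (`age K t s`, e.g. the age of its oldest healed large-field component, `0` = none); (`hdev`) a term of age `n` deviates from `c_K` by at most
`u (K − n)` — the two runs' discrepancy on a component BORN at scale `K − n`, scale-geometric: `0 ≤ u j ≤ C·θ^j`, `0 ≤ θ < 1`; (`hR`) every deviation is `≤ R` (positivity-only
matching of the worst components); (`hwt`) inside every coarse-good fibre the age-`n` terms carry p-weight fraction `≤ a n` with `a ∈ ℓ¹₊` (the ACTIVITY of an age-`n` component);
`0 < vol`.  THEN the fibre sums carry N19′'s slot at the coarse key: `∃ δ, Core l₀ vol T Bad (classVal S π p) (classVal S π q) δ ∧ Summable δ`, with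
`δ_K = e^R·(Σ_{j+n=K} u j·a n)∕vol` — the age ⊛ scale convolution of Part III (`summable_transportedTotal` at `c = 0`, `E = 1`).  Every input is a displayed HYPOTHESIS. -/
theorem coreEdge_classVal_of_ageActivity (hvol : 0 < vol) (hC : 0 ≤ C) (hθ : 0 ≤ θ) (hθ1 : θ < 1)
    (hu0 : ∀ j, 0 ≤ u j) (hu : ∀ j, u j ≤ C * θ ^ j) (ha0 : ∀ n, 0 ≤ a n) (ha : Summable a)
    (hp : ∀ (K : ℕ) (t : ℝ), |t| ≤ l₀ → ∀ τ ∈ T K \ Bad K t, ∀ s ∈ (S K).filter (fun s => π K s = τ), 0 < p K t s)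
    (hq : ∀ (K : ℕ) (t : ℝ), |t| ≤ l₀ → ∀ τ ∈ T K \ Bad K t, ∀ s ∈ (S K).filter (fun s => π K s = τ), 0 < q K t s)
    (hage : ∀ (K : ℕ) (t : ℝ), |t| ≤ l₀ → ∀ τ ∈ T K \ Bad K t, ∀ s ∈ (S K).filter (fun s => π K s = τ), age K t s ≤ K)
    (hdev : ∀ K : ℕ, ∃ c : ℝ, ∀ t : ℝ, |t| ≤ l₀ → ∀ τ ∈ T K \ Bad K t, ∀ s ∈ (S K).filter (fun s => π K s = τ),
      |Real.log (q K t s) - Real.log (p K t s) - c| ≤ u (K - age K t s) ∧ |Real.log (q K t s) - Real.log (p K t s) - c| ≤ R)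
    (hwt : ∀ (K : ℕ) (t : ℝ), |t| ≤ l₀ → ∀ τ ∈ T K \ Bad K t, ∀ n : ℕ,
      ∑ s ∈ ((S K).filter (fun s => π K s = τ)).filter (fun s => age K t s = n), p K t s ≤ a n * ∑ s ∈ (S K).filter (fun s => π K s = τ), p K t s) :
    ∃ δ : ℕ → ℝ, Core l₀ vol T Bad (classVal S π p) (classVal S π q) δ ∧ Summable δ := by
  -- the mean letter: m K := (Σ_{antidiagonal K} u·a) / vol
  have hconv : Summable fun K : ℕ => (1 : ℝ) * ∑ x ∈ antidiagonal K, (fun (_ : ℕ) (j : ℕ) => u j) K x.1 * a x.2 :=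
    summable_transportedTotal (c := 0) zero_le_one hC hθ hθ1 (fun K j _ => ⟨hu0 j, by simpa using hu j⟩) ha0 (by simpa using ha)
  refine coreEdge_classVal_of_meanDeviation (R := fun _ => R) (m := fun K => (∑ x ∈ antidiagonal K, u x.1 * a x.2) / vol) (fun _ => le_rfl) hp hq
    (fun K => ?_) (fun K => div_nonneg (Finset.sum_nonneg fun x _ => mul_nonneg (hu0 _) (ha0 _)) hvol.le) ((by simpa using hconv : Summable fun K : ℕ =>
      ∑ x ∈ antidiagonal K, u x.1 * a x.2).div_const vol)
  obtain ⟨c, hc⟩ := hdev K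
  refine ⟨c, fun t ht τ hτ => ⟨fun s hs => (hc t ht τ hτ s hs).2, ?_⟩⟩
  have hmean := sum_mul_abs_le_of_ageProfile (F := (S K).filter (fun s => π K s = τ)) (p := p K t) (r := fun s => Real.log (q K t s) - Real.log (p K t s) - c)
    (age := age K t) (d := fun n => u (K - n)) (w := a) (K := K) (fun s hs => (hp K t ht τ hτ s hs).le) (hage K t ht τ hτ) (fun n => hu0 _)
    (fun s hs => (hc t ht τ hτ s hs).1) (hwt K t ht τ hτ)
  rw [sum_range_succ_eq_sum_antidiagonal a u K] at hmean
  rwa [mul_div_cancel₀ _ hvol.ne']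

end CoarseRoad

end Summit.QuantumFields.YangMills.BalabanUVNodes.N19FibreAveragingGain

end
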